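import Summits.CriticalPhenomena.SAWScalingLimit.Theorems.SAWDefectDecoherenceBoundaryClosureRPolygonLimitData
import Summits.CriticalPhenomena.SAWScalingLimit.Theorems.SAWDefectDecoherenceBoundaryClosureRPolygonLocalIdentity
import Summits.CriticalPhenomena.SAWScalingLimit.Theorems.SAWDefectDecoherenceBoundaryClosureRGateProfileOfIdentification
import Summits.CriticalPhenomena.SAWScalingLimit.Theorems.SAWDefectDecoherenceBoundaryClosureRExactPolygonCovers
import Summits.CriticalPhenomena.SAWScalingLimit.Theorems.SAWDefectDecoherenceBoundaryClosureRRootIntegrable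
import Summits.CriticalPhenomena.SAWScalingLimit.Theorems.SAWDefectDecoherenceBoundaryClosureRPhaseGeometry
import Summits.CriticalPhenomena.SAWScalingLimit.Theorems.SAWDefectDecoherenceBoundaryClosureRZigzagHalfLattice
import Summits.CriticalPhenomena.SAWScalingLimit.Theorems.SAWDefectDecoherenceBoundaryClosureRPhaseBookkeeping
import Summits.CriticalPhenomena.SAWScalingLimit.Theorems.SAWDefectDecoherenceBoundaryClosureRTransportRigidity
import HarnessLib

/-!
# Identification on exact polygons — the glue of mechanism (A) (crux `BoundaryClosureR`,
# stmt-CriticalPhenomena-14004, line `polygon-parity-squeeze`, stub `stub_polygonIdentification`)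

`stub_polygonIdentification : PolygonPackage → DefectDecoherence → MassRatio → PolygonGateProfile` is
assembled here from the registered pieces of the (A) assembly: `polygonLimitData` (C1, p156917),
`polygonLocalIdentity` (C2, p160207), `boundaryPhaseBookkeeping` (D), `transportRigidity` (E),
`gateProfile_of_identification` (F, p156768), `exactPolygon_covers` (p162294) and
`rootIntegrable_of_limitData` (p161992).  `polygonIdentification_of` displays D and E as hypotheses (the
composition was checked before they landed); `stub_polygonIdentification` — the REGISTERED stub of the line
`polygon-parity-squeeze`, verbatim header — instantiates them with the landed theorems.
-/

noncomputable section

open scoped BigOperators Topology ContDiff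
open Filter Set MeasureTheory Metric
open Literature.Probability.LatticeModels Literature.Probability.RandomPlanarGeometry
open Literature.Probability.RandomPlanarGeometry.SAW
open Summit.CriticalPhenomena.SAWScalingLimit.Theses.SAWDefectDecoherence

namespace Summit.CriticalPhenomena.SAWScalingLimit.Theorems.PolygonParitySqueeze

/-- **The identification on exact polygons, modulo the phase bookkeeping (D) and the transport
rigidity (E).**  For an exact polygon admissible pinned datum with the polygon package,
`DefectDecoherence` and `MassRatio`: the gate profile law on `B(pt 1, ρ/2)`.  Proof: `F` reduces the
claim to, for every frame and mesh sequence, a subsequence with side-measure convergence, the local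
gate identity and `g = c·e^{(5/8)(L − L_b)}`; `C1` supplies the subsequence and the limit data,
`C2` the phase function `κ` and the local identity on flat balls (phase `−√3·n_k·κ`, which on the gate
is `−√3·i` by `κ = 1`, `n_0 = i`), `D` the phase invariant, the covers lemma and root integrability
feed `E`, which identifies `g`. [cite: DuminilCopinSmirnov2012, Conjecture 2 (boundary shadow on the gate)] -/
theorem polygonIdentification_of : (∀ (D : DobrushinDomain) (ρ : ℝ) (Λ : ℝ → Finset HexVertex) (m : ℝ → ℤ) (b : ℝ → Sym2 HexVertex), AdmissibleFamily D ρ Λ m b → ExactPolygonFamily D Λ → ∀ (a : ℝ → Sym2 HexVertex) (r₀ : ℝ) (m₀ : ℝ → ℤ), PinnedFlatRoot D Λ b (D.pt 0) a r₀ m₀ → 2 * ρ < dist (D.pt 0) (D.pt 1) → ∀ (Φ : ConformalEquiv D.carrier UpperHalfPlane.upperHalfPlaneSet) (L : ℂ → ℂ) (Lb : ℂ), ConformalFrame D Φ L Lb → ∀ (κ : ℂ → ℂ), (∀ z ∈ frontier D.carrier, ‖κ z‖ = 1) → (∀ z ∈ frontier D.carrier, z ≠ D.pt 0 → ∀ (k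 : Fin 6) (s : ℝ), 0 < s → D.carrier ∩ Metric.ball z s = halfPlane k z ∩ Metric.ball z s → (∀ᶠ δ : ℝ in 𝓝[>] 0, ∃ nthr : ℤ, ∀ v : HexVertex, (δ : ℂ) * hexCenter v ∈ Metric.ball z s → (v ∈ Λ δ ↔ nthr ≤ zigzagForm k v)) → D.pt 0 ∉ Metric.closedBall z s → ∀ z' ∈ frontier D.carrier ∩ Metric.ball z s, κ z' = κ z) → (∀ z ∈ frontier D.carrier ∩ Metric.ball (D.pt 1) ρ, κ z = 1) → (∀ z ∈ frontier D.carrier, ∀ (k k' : Fin 6) (s : ℝ), 0 < s → innerNormal k' ≠ innerNormal k → innerNormal k' ≠ -innerNormal k → (D.carrier ∩ Metric.ball z s = halfPlane k z ∩ halfPlane k' z ∩ Metric.ball z s ∨ D.carrier ∩ Metric.ball z s = (halfPlane k z ∪ halfPlane k' z) ∩ Metric.ball z s) → (∀ᶠ δ : ℝ in 𝓝[>] 0, ∃ nk nk' : ℤ, (∀ v : HexVertex, (δ : ℂ) * hexCenter v ∈ Metric.ball z s → (v ∈ Λ δ ↔ (nk ≤ zigzagForm k v ∧ nk' ≤ zigzagForm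 k' v))) ∨ (∀ v : HexVertex, (δ : ℂ) * hexCenter v ∈ Metric.ball z s → (v ∈ Λ δ ↔ (nk ≤ zigzagForm k v ∨ nk' ≤ zigzagForm k' v)))) → D.pt 0 ∉ Metric.closedBall z s → ∀ z₁ ∈ frontier D.carrier ∩ Metric.ball z s, ∀ z₂ ∈ frontier D.carrier ∩ Metric.ball z s, z₁ ≠ z → ((z₁ - z) * (starRingEnd ℂ) (innerNormal k)).re = 0 → z₂ ≠ z → ((z₂ - z) * (starRingEnd ℂ) (innerNormal k')).re = 0 → κ z₂ = Complex.exp (-(5 / 8 : ℂ) * (Complex.arg (innerNormal k' / innerNormal k) : ℂ) * Complex.I) * κ z₁) → ∀ z ∈ frontier D.carrier, z ≠ D.pt 0 → ∀ (k : Fin 6) (s : ℝ), 0 < s → D.carrier ∩ Metric.ball z s = halfPlane k z ∩ Metric.ball z s → (∀ᶠ δ : ℝ in 𝓝[>] 0, ∃ nthr : ℤ, ∀ v : HexVertex, (δ : ℂ) * hexCenter v ∈ Metric.ball z s → (v ∈ Λ δ ↔ nthr ≤ zigzagForm k v)) → D.pt 0 ∉ Metric.closedBall z s → ∃ α : ℝ,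 Filter.Tendsto (fun w => (L w).im) (𝓝[D.carrier] z) (𝓝 α) ∧ κ z * innerNormal k * Complex.exp ((3 / 8 : ℂ) * (α : ℂ) * Complex.I) = Complex.I * Complex.exp ((3 / 8 : ℂ) * (Lb.im : ℂ) * Complex.I)) → (∀ (D : DobrushinDomain) (ρ : ℝ) (Λ : ℝ → Finset HexVertex) (m : ℝ → ℤ) (b : ℝ → Sym2 HexVertex), AdmissibleFamily D ρ Λ m b → ExactPolygonFamily D Λ → ∀ (a : ℝ → Sym2 HexVertex) (r₀ : ℝ) (m₀ : ℝ → ℤ), PinnedFlatRoot D Λ b (D.pt 0) a r₀ m₀ → 2 * ρ < dist (D.pt 0) (D.pt 1) → ∀ (corners : Finset ℂ), (↑corners : Set ℂ) ⊆ frontier D.carrier → (∀ z ∈ frontier D.carrier, z ≠ D.pt 0 → z ∉ corners → ∃ (k : Fin 6) (s : ℝ), 0 < s ∧ D.carrier ∩ Metric.ball z s = halfPlane k z ∩ Metric.ball z s ∧ (∀ᶠ δ : ℝ in 𝓝[>] 0, ∃ nthr : ℤ, ∀ v : HexVertex, (δ : ℂ) * hexCenter v ∈ Metric.ball z s → (v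 ∈ Λ δ ↔ nthr ≤ zigzagForm k v)) ∧ D.pt 0 ∉ Metric.closedBall z s) → (∀ c ∈ corners, ∃ (k k' : Fin 6) (s : ℝ), 0 < s ∧ innerNormal k' ≠ innerNormal k ∧ innerNormal k' ≠ -innerNormal k ∧ (D.carrier ∩ Metric.ball c s = halfPlane k c ∩ halfPlane k' c ∩ Metric.ball c s ∨ D.carrier ∩ Metric.ball c s = (halfPlane k c ∪ halfPlane k' c) ∩ Metric.ball c s) ∧ D.pt 0 ∉ Metric.closedBall c s) → ∀ (Φ : ConformalEquiv D.carrier UpperHalfPlane.upperHalfPlaneSet) (L : ℂ → ℂ) (Lb : ℂ), ConformalFrame D Φ L Lb → ∀ (g : ℂ → ℂ) (μ : MeasureTheory.Measure ℂ), DifferentiableOn ℂ g D.carrier → (∀ K : Set ℂ, IsCompact K → MeasureTheory.IntegrableOn g (K ∩ D.carrier)) → (∀ K : Set ℂ, IsCompact K → D.pt 0 ∉ K → μ K < ⊤) → μ (frontier D.carrier)ᶜ = 0 → ∀ (κ : ℂ → ℂ), (∀ z ∈ frontier D.carrier, ‖κ z‖ = 1) → (∀ z ∈ frontier D.carrier,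 z ≠ D.pt 0 → ∀ (k : Fin 6) (s : ℝ), 0 < s → D.carrier ∩ Metric.ball z s = halfPlane k z ∩ Metric.ball z s → (∀ᶠ δ : ℝ in 𝓝[>] 0, ∃ nthr : ℤ, ∀ v : HexVertex, (δ : ℂ) * hexCenter v ∈ Metric.ball z s → (v ∈ Λ δ ↔ nthr ≤ zigzagForm k v)) → D.pt 0 ∉ Metric.closedBall z s → ∀ z' ∈ frontier D.carrier ∩ Metric.ball z s, κ z' = κ z) → (∀ z ∈ frontier D.carrier, z ≠ D.pt 0 → ∀ (k : Fin 6) (s : ℝ), 0 < s → D.carrier ∩ Metric.ball z s = halfPlane k z ∩ Metric.ball z s → (∀ᶠ δ : ℝ in 𝓝[>] 0, ∃ nthr : ℤ, ∀ v : HexVertex, (δ : ℂ) * hexCenter v ∈ Metric.ball z s → (v ∈ Λ δ ↔ nthr ≤ zigzagForm k v)) → D.pt 0 ∉ Metric.closedBall z s → ∀ φ : ℂ → ℂ, ContDiff ℝ ∞ φ → HasCompactSupport φ → tsupport φ ⊆ Metric.ball z (s / 2) → ∫ w in D.carrier, g w * Literature.Analysis.Complex.dbarAlong 1 φ w = -(Real.sqrt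 3 : ℂ) * innerNormal k * κ z * ∫ w, φ w ∂μ) → (∀ z ∈ frontier D.carrier ∩ Metric.ball (D.pt 1) ρ, κ z = 1) → (∀ z ∈ frontier D.carrier, ∀ (k k' : Fin 6) (s : ℝ), 0 < s → innerNormal k' ≠ innerNormal k → innerNormal k' ≠ -innerNormal k → (D.carrier ∩ Metric.ball z s = halfPlane k z ∩ halfPlane k' z ∩ Metric.ball z s ∨ D.carrier ∩ Metric.ball z s = (halfPlane k z ∪ halfPlane k' z) ∩ Metric.ball z s) → (∀ᶠ δ : ℝ in 𝓝[>] 0, ∃ nk nk' : ℤ, (∀ v : HexVertex, (δ : ℂ) * hexCenter v ∈ Metric.ball z s → (v ∈ Λ δ ↔ (nk ≤ zigzagForm k v ∧ nk' ≤ zigzagForm k' v))) ∨ (∀ v : HexVertex, (δ : ℂ) * hexCenter v ∈ Metric.ball z s → (v ∈ Λ δ ↔ (nk ≤ zigzagForm k v ∨ nk' ≤ zigzagForm k' v)))) → D.pt 0 ∉ Metric.closedBall z s → ∀ z₁ ∈ frontier D.carrier ∩ Metric.ball z s, ∀ z₂ ∈ frontier D.carrier ∩ Metric.ball z s, z₁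 ≠ z → ((z₁ - z) * (starRingEnd ℂ) (innerNormal k)).re = 0 → z₂ ≠ z → ((z₂ - z) * (starRingEnd ℂ) (innerNormal k')).re = 0 → κ z₂ = Complex.exp (-(5 / 8 : ℂ) * (Complex.arg (innerNormal k' / innerNormal k) : ℂ) * Complex.I) * κ z₁) → (∀ z ∈ frontier D.carrier, z ≠ D.pt 0 → ∀ (k : Fin 6) (s : ℝ), 0 < s → D.carrier ∩ Metric.ball z s = halfPlane k z ∩ Metric.ball z s → (∀ᶠ δ : ℝ in 𝓝[>] 0, ∃ nthr : ℤ, ∀ v : HexVertex, (δ : ℂ) * hexCenter v ∈ Metric.ball z s → (v ∈ Λ δ ↔ nthr ≤ zigzagForm k v)) → D.pt 0 ∉ Metric.closedBall z s → ∃ α : ℝ, Filter.Tendsto (fun w => (L w).im) (𝓝[D.carrier] z) (𝓝 α) ∧ κ z * innerNormal k * Complex.exp ((3 / 8 : ℂ) * (α : ℂ) * Complex.I) = Complex.I * Complex.exp ((3 / 8 : ℂ) * (Lb.im : ℂ) * Complex.I)) → ∃ c : ℂ, ∀ w ∈ D.carrier, g w = c * Complex.exp ((5 / 8 : ℂ)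 * (L w - Lb))) → ((∀ (D : DobrushinDomain) (ρ : ℝ) (Λ : ℝ → Finset HexVertex) (m : ℝ → ℤ) (b : ℝ → Sym2 HexVertex), AdmissibleFamily D ρ Λ m b → ExactPolygonFamily D Λ → ∀ (a : ℝ → Sym2 HexVertex) (r₀ : ℝ) (m₀ : ℝ → ℤ), PinnedFlatRoot D Λ b (D.pt 0) a r₀ m₀ → (∀ K : Set ℂ, IsCompact K → K ⊆ closure D.carrier → D.pt 0 ∉ K → L1BoundOn Λ a b K) ∧ RootTightAt Λ a b (D.pt 0)) ∧ (∀ (D : DobrushinDomain) (ρ : ℝ) (Λ : ℝ → Finset HexVertex) (m : ℝ → ℤ) (b : ℝ → Sym2 HexVertex), AdmissibleFamily D ρ Λ m b → ExactPolygonFamily D Λ → ∀ (a : ℝ → Sym2 HexVertex) (r₀ : ℝ) (m₀ : ℝ → ℤ), PinnedFlatRoot D Λ b (D.pt 0) a r₀ m₀ → (∀ z ∈ frontier D.carrier, z ≠ D.pt 0 → BoundaryLayerBudgetAt Λ a b z) ∧ (2 * ρ < dist (D.pt 0) (D.pt 1) → GateLayerBudgetAt D (ρ / 2) Λ m a b))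 ∧ (∀ (D : DobrushinDomain) (ρ : ℝ) (Λ : ℝ → Finset HexVertex) (m : ℝ → ℤ) (b : ℝ → Sym2 HexVertex), AdmissibleFamily D ρ Λ m b → ExactPolygonFamily D Λ → ∀ (a : ℝ → Sym2 HexVertex) (r₀ : ℝ) (m₀ : ℝ → ℤ), PinnedFlatRoot D Λ b (D.pt 0) a r₀ m₀ → RatioMixingAt Λ a b)) → DefectDecoherence → MassRatio → ∀ (D : DobrushinDomain) (ρ : ℝ) (Λ : ℝ → Finset HexVertex) (m : ℝ → ℤ) (b : ℝ → Sym2 HexVertex), AdmissibleFamily D ρ Λ m b → ExactPolygonFamily D Λ → ∀ (a : ℝ → Sym2 HexVertex) (r₀ : ℝ) (m₀ : ℝ → ℤ), PinnedFlatRoot D Λ b (D.pt 0) a r₀ m₀ → 2 * ρ < dist (D.pt 0) (D.pt 1) → GateProfileAt D ρ (ρ / 2) Λ a b := by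
  intro hD hE hPP hDD hMR D ρ Λ m b hAF hEx a r₀ m₀ hPR hdist
  obtain ⟨hPL1, hPLB, hPRM⟩ := hPP
  have hL1 := (hPL1 D ρ Λ m b hAF hEx a r₀ m₀ hPR).1
  have hRT := (hPL1 D ρ Λ m b hAF hEx a r₀ m₀ hPR).2
  have hBud := (hPLB D ρ Λ m b hAF hEx a r₀ m₀ hPR).1
  have hMix := hPRM D ρ Λ m b hAF hEx a r₀ m₀ hPR
  refine gateProfile_of_identification D ρ Λ m b hAF hEx a r₀ m₀ hPR hdist hMix ?_
  intro Φ L Lb hfr ns hns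
  -- C1: subsequence and limit data
  obtain ⟨ms, g, μ, η, hms, hg, hbulk, hin, hbd, hL1g, hroot, hmf, hms0, hside⟩ :=
    polygonLimitData D ρ Λ m b hAF hEx a r₀ m₀ hPR hdist hL1 hRT hBud hDD hMR ns hns
  have hns' : Tendsto (fun n => ns (ms n)) atTop (𝓝[>] 0) := hns.comp hms.tendsto_atTop
  -- C2: the phase function and the local identity
  obtain ⟨κ, hK1, hK2c, hK2i, hK3, hK4⟩ :=
    polygonLocalIdentity D ρ Λ m b hAF hEx a r₀ m₀ hPR hdist hL1 hRT hBud hDD hMR (fun n => ns (ms n))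
      g μ η hns' hg hbulk hin hbd hL1g hroot hmf hms0 hside
  -- D: the phase invariant
  have hPH := hD D ρ Λ m b hAF hEx a r₀ m₀ hPR hdist Φ L Lb hfr κ hK1 hK2c hK3 hK4
  -- covers and root integrability
  obtain ⟨corners, hcsub, hFLAT, hCORN⟩ := exactPolygon_covers D ρ Λ m b hAF hEx a r₀ m₀ hPR hdist Φ hfr.1
  have hCORNc : ∀ c ∈ corners, ∃ (k k' : Fin 6) (s : ℝ), 0 < s ∧ innerNormal k' ≠ innerNormal k ∧
      innerNormal k' ≠ -innerNormal k ∧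
      (D.carrier ∩ Metric.ball c s = halfPlane k c ∩ halfPlane k' c ∩ Metric.ball c s ∨
        D.carrier ∩ Metric.ball c s = (halfPlane k c ∪ halfPlane k' c) ∩ Metric.ball c s) ∧
      D.pt 0 ∉ Metric.closedBall c s := by
    intro c hc
    obtain ⟨k, k', s, hs, h1, h2, h3, -, h5⟩ := hCORN c hc
    exact ⟨k, k', s, hs, h1, h2, h3, h5⟩
  obtain ⟨r, hr, hgr⟩ := rootIntegrable_of_limitData D Λ a b (fun n => ns (ms n)) g η hns' hRT hg hbulk hin
  have hgall : ∀ K : Set ℂ, IsCompact K → IntegrableOn g (K ∩ D.carrier) := by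
    intro K hK
    have hK' : IsCompact (K \ Metric.ball (D.pt 0) r) := hK.diff Metric.isOpen_ball
    have h0 : D.pt 0 ∉ K \ Metric.ball (D.pt 0) r := fun h => h.2 (Metric.mem_ball_self hr)
    have h1 := hL1g _ hK' h0
    have hsub : K ∩ D.carrier ⊆ (Metric.ball (D.pt 0) r ∩ D.carrier) ∪ ((K \ Metric.ball (D.pt 0) r) ∩ D.carrier) := by
      intro z hz
      by_cases hzr : z ∈ Metric.ball (D.pt 0) r
      · exact Or.inl ⟨hzr, hz.2⟩
      · exact Or.inr ⟨⟨hz.1, hzr⟩, hz.2⟩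
    exact (hgr.union h1).mono_set hsub
  -- E: identification of `g`
  obtain ⟨c, hc⟩ := hE D ρ Λ m b hAF hEx a r₀ m₀ hPR hdist corners hcsub hFLAT hCORNc Φ L Lb hfr g μ hg
    hgall hmf hms0 κ hK1 hK2c hK2i hK3 hK4 hPH
  refine ⟨ms, g, μ, c, hms, hmf, hside, ?_, hc⟩
  -- the local gate identity, from K2i at gate points with `κ = 1`, `n_0 = i`
  intro y hy
  obtain ⟨hyf, hyb⟩ := hy
  have hρ : 0 < ρ := hAF.1
  set s : ℝ := (ρ - dist y (D.pt 1)) / 2 with hsdef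
  have hyb' : dist y (D.pt 1) < ρ := hyb
  have hs : 0 < s := by rw [hsdef]; linarith
  have hsub : Metric.ball y s ⊆ Metric.ball (D.pt 1) ρ := by
    intro w hw
    rw [Metric.mem_ball] at hw ⊢
    have := dist_triangle w y (D.pt 1)
    rw [hsdef] at hw
    linarith
  have hflat1 : D.carrier ∩ Metric.ball (D.pt 1) ρ = halfPlane 0 (D.pt 1) ∩ Metric.ball (D.pt 1) ρ := by
    rw [halfPlane_zero]; exact hAF.2.1
  have hlev := PhaseGeometry.level_eq_zero_of_mem_frontier D.isOpen hflat1 hyf hyb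
  have hflaty : D.carrier ∩ Metric.ball y s = halfPlane 0 y ∩ Metric.ball y s :=
    PhaseGeometry.flat_of_subset hflat1 hsub hlev
  have hlat : ∀ᶠ δ : ℝ in 𝓝[>] 0, ∃ nthr : ℤ, ∀ v : HexVertex,
      (δ : ℂ) * hexCenter v ∈ Metric.ball y s → (v ∈ Λ δ ↔ nthr ≤ zigzagForm 0 v) := by
    filter_upwards [hAF.2.2.1] with δ hδ
    refine ⟨m δ, fun v hv => ?_⟩
    have h := hδ.2.2.2.2 v (hsub hv)
    simpa [zigzagForm] using h
  have hy0 : y ≠ D.pt 0 := by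
    intro h
    rw [h] at hyb'
    linarith [hdist, hρ]
  have hroot0 : D.pt 0 ∉ Metric.closedBall y s := by
    intro h
    rw [Metric.mem_closedBall] at h
    have h1 := dist_triangle (D.pt 0) y (D.pt 1)
    have h2 : s < ρ := by rw [hsdef]; linarith [dist_nonneg (x := y) (y := D.pt 1)]
    linarith
  refine ⟨s / 2, by positivity, ?_⟩
  intro φ hφ hφc hφs
  have hid := hK2i y hyf hy0 0 s hs hflaty hlat hroot0 φ hφ hφc hφs
  have hκ : κ y = 1 := hK3 y ⟨hyf, hyb⟩
  have hn0 : innerNormal 0 = Complex.I := by simp [innerNormal]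
  rw [hid, hκ, hn0, mul_one]

/-- **STUB `stub_polygonIdentification` of line `polygon-parity-squeeze` (mechanism (A): identification on
exact polygons)** — `PolygonPackage → DefectDecoherence → MassRatio → PolygonGateProfile`, registered header
verbatim: the glue `polygonIdentification_of` instantiated with the landed phase bookkeeping
(`boundaryPhaseBookkeeping`) and transport rigidity (`transportRigidity`).
[cite: DuminilCopinSmirnov2012, Conjecture 2 (boundary shadow on the gate)] -/
theorem stub_polygonIdentification : ((∀ (D : DobrushinDomain) (ρ : ℝ) (Λ : ℝ → Finset HexVertex) (m : ℝ → ℤ) (b : ℝ → Sym2 HexVertex), AdmissibleFamily D ρ Λ m b → ExactPolygonFamily D Λ → ∀ (a : ℝ → Sym2 HexVertex) (r₀ : ℝ) (m₀ : ℝ → ℤ), PinnedFlatRoot D Λ b (D.pt 0) a r₀ m₀ → (∀ K : Set ℂ, IsCompact K → K ⊆ closure D.carrier → D.pt 0 ∉ K → L1BoundOn Λ a b K) ∧ RootTightAt Λ a b (D.pt 0)) ∧ (∀ (D : DobrushinDomain) (ρ : ℝ) (Λ : ℝ → Finset HexVertex) (m : ℝ → ℤ) (b : ℝ → Sym2 HexVertex),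 AdmissibleFamily D ρ Λ m b → ExactPolygonFamily D Λ → ∀ (a : ℝ → Sym2 HexVertex) (r₀ : ℝ) (m₀ : ℝ → ℤ), PinnedFlatRoot D Λ b (D.pt 0) a r₀ m₀ → (∀ z ∈ frontier D.carrier, z ≠ D.pt 0 → BoundaryLayerBudgetAt Λ a b z) ∧ (2 * ρ < dist (D.pt 0) (D.pt 1) → GateLayerBudgetAt D (ρ / 2) Λ m a b)) ∧ (∀ (D : DobrushinDomain) (ρ : ℝ) (Λ : ℝ → Finset HexVertex) (m : ℝ → ℤ) (b : ℝ → Sym2 HexVertex), AdmissibleFamily D ρ Λ m b → ExactPolygonFamily D Λ → ∀ (a : ℝ → Sym2 HexVertex) (r₀ : ℝ) (m₀ : ℝ → ℤ), PinnedFlatRoot D Λ b (D.pt 0) a r₀ m₀ → RatioMixingAt Λ a b)) → DefectDecoherence → MassRatio → ∀ (D : DobrushinDomain) (ρ : ℝ) (Λ : ℝ → Finset HexVertex) (m : ℝ → ℤ) (b : ℝ → Sym2 HexVertex), AdmissibleFamily D ρ Λ m b → ExactPolygonFamily D Λ → ∀ (a : ℝ → Sym2 HexVertex) (r₀ : ℝ)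 (m₀ : ℝ → ℤ), PinnedFlatRoot D Λ b (D.pt 0) a r₀ m₀ → 2 * ρ < dist (D.pt 0) (D.pt 1) → GateProfileAt D ρ (ρ / 2) Λ a b :=
  polygonIdentification_of boundaryPhaseBookkeeping transportRigidity

end Summit.CriticalPhenomena.SAWScalingLimit.Theorems.PolygonParitySqueeze

end
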